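import Summits.CriticalPhenomena.PercolationContinuityZ3.Theorems.PercNearOneGluingNoHeavyLowerTailThreePartitionCubeSymA
import Mathlib.Data.Fin.Tuple.Sort
import Mathlib.Data.Prod.Lex

/-!
# Twisted three-partition positivity (★★) = (M⁺-3) on SIX letters: soundness of the checker, XI — **covariance of the keys under coordinate
# permutations, the sorting permutation, and the key bounds**

Support file (cell `prim-sahi`, seat `prim-sahi-typer` gen 34; `--supports stmt-CriticalPhenomena-4575`).  Pure, plus the definition `cperm`
(the action of a coordinate permutation on codes); no `sorry`, standard axioms.
* `cperm σ x = encS (σ '' pt m x)`; `testBit_cperm`, `pc_cperm`, `cperm_land`, `cperm_injOn`; `gS_cperm`, `gQ_cperm`;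
* **covariance**: `statS_image_cperm`, `statF_image_cperm`, `statD_image_cperm` — the statistics of the permuted code set at coordinate `i`
  are those of the original at `σ⁻¹ i` (and hence `statTri`, by `two_mul_statTri_add_statD`);
* **`exists_perm_monotone`** — for any key function `f : Fin m → Lex (ℕ × ℕ)` there is `σ` with `i ↦ f (σ⁻¹ i)` monotone (`Tuple.sort`);
* bounds: `pc_le`, `gQ_le`, `statF_le`; `statS_le_of_key_le` — sorted full keys force sorted first-order keys once `statTri < C40`. [this work]
-/

namespace Summit.CriticalPhenomena.PercolationContinuityZ3.Theorems.ThreePartition.Cube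

open Finset SahiGridPattern.Pair43 SahiC3Cube
open scoped Classical

variable {m : ℕ}

/-! ### Codes and points -/

/-- `pt` of an AND is the intersection. [this work] -/
theorem pt_land (m x x' : ℕ) : pt m (x &&& x') = pt m x ∩ pt m x' := by
  ext i; simp [pt]

/-- Bits of `encS`. [this work] -/
theorem testBit_encS_iff (S : Set (Fin m)) (i : Fin m) : (encS S).testBit i.val = true ↔ i ∈ S := by
  have h : i ∈ pt m (encS S) ↔ i ∈ S := by rw [pt_encS]
  simpa only [pt, Set.mem_setOf_eq] using h

/-- `encS` of an intersection is the AND. [this work] -/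
theorem encS_inter (S S' : Set (Fin m)) : encS (S ∩ S') = encS S &&& encS S' := by
  refine eq_of_pt_eq (encS_lt _) (lt_of_le_of_lt Nat.and_le_left (encS_lt _)) ?_
  rw [pt_land, pt_encS, pt_encS, pt_encS]

/-- `pc m x` is the number of coordinates of the point (as a filter of `Fin m`). [this work] -/
theorem pc_eq_card_fin (m x : ℕ) : pc m x = (univ.filter fun i : Fin m => x.testBit i.val = true).card := by
  rw [pc_eq_card, ← card_map Fin.valEmbedding]
  congr 1
  ext n
  simp only [mem_filter, mem_range, mem_map, mem_univ, true_and, Fin.valEmbedding_apply]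
  constructor
  · rintro ⟨hn, hb⟩; exact ⟨⟨n, hn⟩, hb, rfl⟩
  · rintro ⟨i, hb, rfl⟩; exact ⟨i.isLt, hb⟩

/-- `pc m x ≤ m`. [this work] -/
theorem pc_le (m x : ℕ) : pc m x ≤ m := by
  rw [pc_eq_card]; exact (card_filter_le _ _).trans (card_range m).le

/-! ### The action of a coordinate permutation on codes -/

/-- The code of the image of the point of `x` under `σ`. [this work] -/
noncomputable def cperm (σ : Equiv.Perm (Fin m)) (x : ℕ) : ℕ := encS (σ '' pt m x)

/-- `cperm σ x < 2^m`. [this work] -/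
theorem cperm_lt (σ : Equiv.Perm (Fin m)) (x : ℕ) : cperm σ x < 2 ^ m := encS_lt _

/-- `pt (cperm σ x) = σ '' pt x`. [this work] -/
theorem pt_cperm (σ : Equiv.Perm (Fin m)) (x : ℕ) : pt m (cperm σ x) = σ '' pt m x := pt_encS _

/-- Bits of `cperm σ x` (coordinates `< m`). [this work] -/
theorem testBit_cperm (σ : Equiv.Perm (Fin m)) (x : ℕ) (i : Fin m) : (cperm σ x).testBit i.val = x.testBit (σ.symm i).val := by
  have h1 : (cperm σ x).testBit i.val = true ↔ x.testBit (σ.symm i).val = true := by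
    unfold cperm
    rw [testBit_encS_iff, Set.mem_image]
    constructor
    · rintro ⟨j, hj, rfl⟩; simpa [pt] using hj
    · intro h; exact ⟨σ.symm i, by simpa [pt] using h, by simp⟩
  cases ha : (cperm σ x).testBit i.val <;> cases hb : x.testBit (σ.symm i).val
  · rfl
  · exact absurd (h1.2 hb) (by rw [ha]; exact Bool.false_ne_true)
  · exact absurd (h1.1 ha) (by rw [hb]; exact Bool.false_ne_true)
  · rfl

/-- `pc` is invariant. [this work] -/
theorem pc_cperm (σ : Equiv.Perm (Fin m)) (x : ℕ) : pc m (cperm σ x) = pc m x := by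
  rw [pc_eq_card_fin, pc_eq_card_fin]
  have h : (univ.filter fun i : Fin m => (cperm σ x).testBit i.val = true) =
      (univ.filter fun i : Fin m => x.testBit i.val = true).map σ.toEmbedding := by
    ext i
    simp only [mem_filter, mem_univ, true_and, mem_map, Equiv.toEmbedding_apply, testBit_cperm]
    constructor
    · intro h; exact ⟨σ.symm i, h, by simp⟩
    · rintro ⟨j, hj, rfl⟩; simpa using hj
  rw [h, card_map]

/-- `cperm` commutes with AND (codes `< 2^m` not needed: only the points matter). [this work] -/
theorem cperm_land (σ : Equiv.Perm (Fin m)) (x x' : ℕ) : cperm σ (x &&& x') = cperm σ x &&& cperm σ x' := by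
  unfold cperm
  rw [pt_land, Set.image_inter σ.injective, encS_inter]

/-- `cperm` is injective on codes `< 2^m`. [this work] -/
theorem cperm_injOn (σ : Equiv.Perm (Fin m)) {x x' : ℕ} (hx : x < 2 ^ m) (hx' : x' < 2 ^ m) (h : cperm σ x = cperm σ x') : x = x' := by
  have h1 := congrArg (pt m) h
  rw [pt_cperm, pt_cperm, Set.image_eq_image σ.injective] at h1
  exact eq_of_pt_eq hx hx' h1

/-- `cperm σ (encS a) = encS (σ '' a)`. [this work] -/
theorem cperm_encS (σ : Equiv.Perm (Fin m)) (a : Set (Fin m)) : cperm σ (encS a) = encS (σ '' a) := by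
  unfold cperm; rw [pt_encS]

/-! ### Covariance of the statistics -/

/-- `gS` is covariant. [this work] -/
theorem gS_cperm (σ : Equiv.Perm (Fin m)) (i : Fin m) (x : ℕ) : gS m i.val (cperm σ x) = gS m (σ.symm i).val x := by
  unfold gS; rw [testBit_cperm, pc_cperm]

/-- `gQ` is covariant. [this work] -/
theorem gQ_cperm (σ : Equiv.Perm (Fin m)) (i : Fin m) (x x' : ℕ) :
    gQ m i.val (cperm σ x) (cperm σ x') = gQ m (σ.symm i).val x x' := by
  unfold gQ; rw [← cperm_land, testBit_cperm, pc_cperm, pc_cperm, pc_cperm]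

/-- A code set below `2^m`. [this work] -/
def CodeSet (m : ℕ) (P : Finset ℕ) : Prop := ∀ x ∈ P, x < 2 ^ m

/-- **`statS` is covariant.** [this work] -/
theorem statS_image_cperm (σ : Equiv.Perm (Fin m)) {P : Finset ℕ} (hP : CodeSet m P) (i : Fin m) :
    statS m (P.image (cperm σ)) i.val = statS m P (σ.symm i).val := by
  unfold statS
  rw [sum_image fun x hx x' hx' h => cperm_injOn σ (hP x hx) (hP x' hx') h]
  exact sum_congr rfl fun x _ => gS_cperm σ i x

/-- **`statF` is covariant.** [this work] -/
theorem statF_image_cperm (σ : Equiv.Perm (Fin m)) {P : Finset ℕ} (hP : CodeSet m P) (i : Fin m) :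
    statF m (P.image (cperm σ)) i.val = statF m P (σ.symm i).val := by
  unfold statF
  rw [sum_image fun x hx x' hx' h => cperm_injOn σ (hP x hx) (hP x' hx') h]
  refine sum_congr rfl fun x _ => ?_
  rw [sum_image fun x hx x' hx' h => cperm_injOn σ (hP x hx) (hP x' hx') h]
  exact sum_congr rfl fun x' _ => gQ_cperm σ i x x'

/-- **`statD` is covariant.** [this work] -/
theorem statD_image_cperm (σ : Equiv.Perm (Fin m)) {P : Finset ℕ} (hP : CodeSet m P) (i : Fin m) :
    statD m (P.image (cperm σ)) i.val = statD m P (σ.symm i).val := by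
  unfold statD
  rw [sum_image fun x hx x' hx' h => cperm_injOn σ (hP x hx) (hP x' hx') h]
  exact sum_congr rfl fun x _ => gQ_cperm σ i x x

/-- **`statTri` is covariant** (for duplicate-free lists enumerating `P` and its image). [this work] -/
theorem statTri_cperm (σ : Equiv.Perm (Fin m)) {P : Finset ℕ} (hP : CodeSet m P) {Q Q' : List ℕ} (hQ : Q.Nodup) (hQ' : Q'.Nodup)
    (hPQ : Q.toFinset = P) (hPQ' : Q'.toFinset = P.image (cperm σ)) (i : Fin m) :
    statTri m Q' i.val = statTri m Q (σ.symm i).val := by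
  have h1 := two_mul_statTri_add_statD hQ m (σ.symm i).val
  have h2 := two_mul_statTri_add_statD hQ' m i.val
  rw [hPQ] at h1
  rw [hPQ', statD_image_cperm σ hP, statF_image_cperm σ hP] at h2
  omega

/-! ### The sorting permutation -/

/-- **For every key function there is a coordinate permutation along whose inverse the keys are sorted.** [this work] -/
theorem exists_perm_monotone {α : Type*} [LinearOrder α] (f : Fin m → α) :
    ∃ σ : Equiv.Perm (Fin m), Monotone fun i => f (σ.symm i) :=
  ⟨(Tuple.sort f).symm, by
    have h := Tuple.monotone_sort f
    simp only [Equiv.symm_symm]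
    exact h⟩

/-- Consecutive comparisons from monotonicity. [this work] -/
theorem succ_le_of_monotone {g : Fin m → ℕ} (hg : Monotone g) {i : ℕ} (hi : i + 1 < m) :
    g ⟨i, by omega⟩ ≤ g ⟨i + 1, hi⟩ :=
  hg (Fin.mk_le_mk.2 (Nat.le_succ i))

/-! ### Bounds -/

/-- `w16 k = 16^k`. [this work] -/
theorem w16_eq (k : ℕ) : w16 k = 16 ^ k := by
  unfold w16; rw [Nat.one_shiftLeft, Nat.pow_mul]

/-- `gQ ≤ 16^m·(3+2m)`. [this work] -/
theorem gQ_le (m i x x' : ℕ) : gQ m i x x' ≤ 16 ^ m * (3 + 2 * m) := by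
  unfold gQ
  split_ifs
  · rw [w16_eq]
    exact Nat.mul_le_mul (Nat.pow_le_pow_right (by norm_num) (pc_le m _)) (by have := pc_le m x; have := pc_le m x'; omega)
  · exact Nat.zero_le _

/-- `statF ≤ |P|²·16^m·(3+2m)`. [this work] -/
theorem statF_le (m : ℕ) (P : Finset ℕ) (i : ℕ) : statF m P i ≤ P.card * P.card * (16 ^ m * (3 + 2 * m)) := by
  unfold statF
  calc ∑ x ∈ P, ∑ x' ∈ P, gQ m i x x' ≤ ∑ x ∈ P, ∑ x' ∈ P, 16 ^ m * (3 + 2 * m) :=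
        sum_le_sum fun x _ => sum_le_sum fun x' _ => gQ_le m i x x'
    _ = P.card * P.card * (16 ^ m * (3 + 2 * m)) := by rw [sum_const, sum_const, smul_eq_mul, smul_eq_mul]; ring

/-- `2·statTri ≤ |Q.toFinset|²·16^m·(3+2m)` (duplicate-free). [this work] -/
theorem two_mul_statTri_le {Q : List ℕ} (hQ : Q.Nodup) (m i : ℕ) :
    2 * statTri m Q i ≤ Q.toFinset.card * Q.toFinset.card * (16 ^ m * (3 + 2 * m)) := by
  have h := two_mul_statTri_add_statD hQ m i
  have h2 := statF_le m Q.toFinset i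
  omega

/-- A code set has at most `2^m` elements. [this work] -/
theorem CodeSet.card_le {P : Finset ℕ} (hP : CodeSet m P) : P.card ≤ 2 ^ m := by
  calc P.card ≤ (range (2 ^ m)).card := card_le_card fun x hx => mem_range.2 (hP x hx)
    _ = 2 ^ m := card_range _

/-- **Sorted full keys force sorted first-order keys** once the second-order parts are `< C40`. [this work] -/
theorem statS_le_of_key_le {s s' q q' : ℕ} (hq : q < C40) (hq' : q' < C40) (h : s * C40 + q ≤ s' * C40 + q') : s ≤ s' := by
  by_contra hlt
  have h1 : s' + 1 ≤ s := by omega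
  have h2 : (s' + 1) * C40 ≤ s * C40 := Nat.mul_le_mul_right _ h1
  have hC : C40 = 2 ^ 40 := by unfold C40; rw [Nat.one_shiftLeft]
  rw [hC] at h2 hq hq' h
  omega

end Summit.CriticalPhenomena.PercolationContinuityZ3.Theorems.ThreePartition.Cube
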